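import Literature.NumberTheory.LFunctions.JensenXiMomentKappaSix
import HarnessLib

/-!
# Degree-`6` Jensen polynomials of `ξ`: the kernel-certified tail family and the headline reduction

Kernel evaluation (`decide +kernel`, one theorem per box, ≈ 1 min each) of the `3` box
certificates of `JensenXiMomentKappaSix.lean`'s tail family (`δ₁ ≤ 1 / 447`, i.e. `n ≥ 100000`;
`κ₂`-slices of width `1/25` on `[0, 3/25]`; `|κ_l| ≤ (1/50)·5^{2-l}`), and the HEADLINE
`jensenHyperbolicFrom_six_of_tailCumulantBounds`: the tail cumulant bounds for all `n ≥ 100000` give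
`J^{6,n}_γ` hyperbolic for all `n ≥ 100000` (no input on the zeros of `ζ`).

## References
* [GORZPNAS2019] Griffin–Ono–Rolen–Zagier, PNAS 116 (2019), Thms. 2–3, §5.2.
-/

noncomputable section

namespace Literature.NumberTheory.LFunctions

set_option maxHeartbeats 4000000 in -- kernel evaluation of one box certificate
/-- Box `(0, 0)` of the tail family is sign-certified (kernel evaluation). [cite: GORZPNAS2019, §5.2] -/
theorem tailBoxesSix_cert_0_0 :
    GPolyCertifies gorzPolySixK (tailBoxesSix 0 0) 6 (tailPointsSix 0) := by
  decide +kernel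

set_option maxHeartbeats 4000000 in -- kernel evaluation of one box certificate
/-- Box `(0, 1)` of the tail family is sign-certified (kernel evaluation). [cite: GORZPNAS2019, §5.2] -/
theorem tailBoxesSix_cert_0_1 :
    GPolyCertifies gorzPolySixK (tailBoxesSix 0 1) 6 (tailPointsSix 1) := by
  decide +kernel

set_option maxHeartbeats 4000000 in -- kernel evaluation of one box certificate
/-- Box `(0, 2)` of the tail family is sign-certified (kernel evaluation). [cite: GORZPNAS2019, §5.2] -/
theorem tailBoxesSix_cert_0_2 :
    GPolyCertifies gorzPolySixK (tailBoxesSix 0 2) 6 (tailPointsSix 2) := by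
  decide +kernel

/-- **The tail family is sign-certified** (all `3` boxes). [cite: GORZPNAS2019, §5.2] -/
theorem tailBoxesSix_certifies (i : Fin 1) (j : Fin 3) :
    GPolyCertifies gorzPolySixK (tailBoxesSix i j) 6 (tailPointsSix j) := by
  fin_cases i; fin_cases j
  · exact tailBoxesSix_cert_0_0
  · exact tailBoxesSix_cert_0_1
  · exact tailBoxesSix_cert_0_2

/-- **HEADLINE (degree `6`):** the tail cumulant bounds for every `n ≥ 100000` give `J^{6,n}_γ`
hyperbolic for every `n ≥ 100000`. [cite: GORZPNAS2019, Thm. 2 and §5.2] -/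
theorem jensenHyperbolicFrom_six_of_tailCumulantBounds
    (h : ∀ n : ℕ, 100000 ≤ n → TailCumulantBoundsSix n) :
    JensenHyperbolicFrom xiTaylorCoeff 6 100000 := by
  intro n hn
  obtain ⟨h0, h1, k3, k4, k5, k6, k7, k8, k9, k10, k11, k12, ⟨e3, e4, e5, e6, e7, e8, e9, e10, e11, e12⟩, hk⟩ := h n hn
  obtain ⟨i, hi⟩ := exists_deltaSliceSix hn
  obtain ⟨j, hj⟩ := exists_kappaTwoSliceSix h0 h1
  exact splits_jensenPoly_six_of_kappaCertifies (tailBoxesSix_certifies i j) _ k3 k4 k5 k6 k7 k8 k9 k10 k11 k12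
    e3 e4 e5 e6 e7 e8 e9 e10 e11 e12 (boxMem_kappaBoxSix hi hj hk)


end Literature.NumberTheory.LFunctions
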